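import Literature.AlgebraicGeometry.Morphisms.CechH2ResolutionDimTwo
import Literature.AlgebraicGeometry.Morphisms.CechModuleFiniteLocallyFreePullback
import Literature.AlgebraicGeometry.Morphisms.CechModuleCoverIndependence
import Literature.AlgebraicGeometry.Morphisms.CechModuleUnit
import Literature.AlgebraicGeometry.Modules.IdealSheafOfClosedImmersion
import Literature.AlgebraicGeometry.Modules.BiprodSections
import Literature.AlgebraicGeometry.Modules.Torsion
import Literature.AlgebraicGeometry.Modules.TwistPushforwardClosedBaseChange
import Literature.AlgebraicGeometry.Resolution.Lipman1969RationalContraction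
import Literature.AlgebraicGeometry.Resolution.RationalResolutionSubschemeH1Vanishing
import HarnessLib

/-!
# Inclusion–exclusion for `h⁰` of closed subschemes of a resolution with `H¹(X, 𝒪_X) = 0`:
# `h⁰(𝒪_X/(𝓐 ∩ 𝓑)) + h⁰(𝒪_X/(𝓐 + 𝓑)) = h⁰(𝒪_X/𝓐) + h⁰(𝒪_X/𝓑)` (Lipman 1969, §13, the `χ = h⁰` calculus)

Topic: `Literature/AlgebraicGeometry/Resolution`.  PROVED, fact-free, definition-free.  J. Lipman, *Rational
singularities, with applications to algebraic surfaces and unique factorization*, Publ. Math. IHÉS 36 (1969), computes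
throughout §§13, 18–23 with the Euler characteristics `χ(𝒪_C)` of the closed subschemes `C` of a desingularization
`X → Spec S` supported in the closed fibre, which are ADDITIVE along exact sequences; in the rational regime (every
quotient `𝒪_X/𝒥` has `H¹ = 0`, `Resolution/RationalResolutionSubschemeH1Vanishing`) `χ = h⁰` and the tree's
`h0 π 𝓘 = length_S Γ(V(𝓘), 𝒪)` (`Resolution/Lipman1969RationalContraction`) inherits this additivity.  The basic
instance, used in the proof of Prop. (13.1) d) (p. 223: `(F·E) = χ(E) + χ(F) − χ(E+F)`, with `𝒪_{E+F} → 𝒪_E ⊕ 𝒪_F →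
𝒪_{E∩F}` for curves without common component), is INCLUSION–EXCLUSION:

  `h⁰(𝒪_X/(𝓐 ∩ 𝓑)) + h⁰(𝒪_X/(𝓐 + 𝓑)) = h⁰(𝒪_X/𝓐) + h⁰(𝒪_X/𝓑)`

from the Chinese-remainder short exact sequence `0 → 𝒪_X/(𝓐∩𝓑) → 𝒪_X/𝓐 ⊕ 𝒪_X/𝓑 → 𝒪_X/(𝓐+𝓑) → 0` and
`H¹(𝒪_X/(𝓐∩𝓑)) = 0`.

* §1 (`Literature.AlgebraicGeometry.Modules`, any scheme) `shortExact_crt_idealQuot` — the CRT sequence of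
  `𝒪_X`-modules for two ideal sheaves `𝓐 𝓑 : X.IdealSheafData` (`Modules.idealQuot (unitModule X) 𝓘 = 𝒪_X/𝓘𝒪_X`;
  maps `qᵢ` = any morphisms compatible with the projections, e.g. `idealQuotDesc`), with
  `idealQuotπ_unit_app_eq_zero_iff` (`Γ(V, 𝒪_X/𝓘) = Γ(V, 𝒪_X)/𝓘(V)` on affine `V`), `mono_biprod_lift_idealQuot`,
  `epi_biprod_desc_idealQuot`, `exact_biprod_lift_desc_idealQuot` (local exactness on affine opens,
  `Modules/LocalExactness`, `Modules/BiprodSections`);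
* §2 `h0_eq_length_MSections_idealQuot` — `h0 π 𝓘 = length_S Γ(X, 𝒪_X/𝓘𝒪_X)` (`𝒪_X/𝓘_Z ≅ ι_*𝒪_Z`,
  `Modules/IdealSheafOfClosedImmersion`); `length_MSections_eq_add_of_shortExact` — lengths of global sections add on
  `0 → M′ → M → M″ → 0` with `M′` affine-localizing and `Ȟ¹(𝒰, M′) = 0` (tree
  `app_top_surjective_of_shortExact_of_subsingleton_cechMH1` + Mathlib `Module.length_eq_add_of_exact`);
  `length_MSections_biprod`;
* §3 **`h0_inf_add_h0_sup`** — inclusion–exclusion on any quasi-compact `S`-scheme given `H¹(𝒪_{V(𝓐∩𝓑)}) = 0` and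
  `H¹(𝒪_{V(𝓐)}) = 0`; **`IsResolution.h0_inf_add_h0_sup`** — unconditionally for all `𝓐`, `𝓑` on a resolution of
  a two-dimensional Noetherian local domain with `H¹(X, 𝒪_X) = 0`; `h0_inf_add_h0_sup_of_hasRationalSingularity` —
  the regime of the named facts (13.1) b), d)_rat, (27.1), (27.3), given Prop. (1.2) 2) (`Lipman1969_1_2`, explicit).

No summit statement is proved; nothing here bears on resolution of singularities in positive characteristic.

## References
* J. Lipman, Publ. Math. IHÉS 36 (1969): §13, Prop. (13.1) and its proof (p. 223); Prop. (1.2) (p. 199). [Lipman1969]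
* R. Hartshorne, *Algebraic Geometry* (1977), II Prop. 5.6, II Prop. 5.9, III proof of Thm. 4.5 (p. 222),
  III Ex. 4.1. [Hartshorne1977]
* U. Görtz, T. Wedhorn, *Algebraic Geometry I* (2nd ed. 2020), Prop. 7.14; *II* (2023), Cor. 24.44.
  [GortzWedhorn2020] [GortzWedhorn2023]
-/

noncomputable section

-- `TopCat.Presheaf`/`Scheme.Modules` are not reducible (as in Mathlib's `AlgebraicGeometry/Modules`).
set_option backward.isDefEq.respectTransparency false

open CategoryTheory CategoryTheory.Limits AlgebraicGeometry TopologicalSpace Opposite IsLocalRing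
open Literature.AlgebraicGeometry.Morphisms Literature.AlgebraicGeometry.Modules

universe u

namespace Literature.AlgebraicGeometry.Modules

/-! ## §1 The Chinese-remainder short exact sequence `0 → 𝒪/(𝓐∩𝓑) → 𝒪/𝓐 ⊕ 𝒪/𝓑 → 𝒪/(𝓐+𝓑) → 0` -/

section CRT

variable {X : Scheme.{u}} (𝓐 𝓑 : X.IdealSheafData)

/-- In `Γ(V, 𝒪_X)` regarded as a module over itself, `𝓘(V) • ⊤ = 𝓘(V)`.
[cite: GortzWedhorn2020, Prop. 7.14 (p. 186)] -/
theorem mem_ideal_smul_top_unitModule_iff (𝓘 : X.IdealSheafData) (V : X.affineOpens)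
    (s : Γ(unitModule X, V)) :
    s ∈ 𝓘.ideal V • (⊤ : Submodule Γ(X, V) Γ(unitModule X, V)) ↔ (s : Γ(X, V)) ∈ 𝓘.ideal V := by
  constructor
  · intro hs
    refine Submodule.smul_induction_on (p := fun m => (m : Γ(X, V)) ∈ 𝓘.ideal V) hs ?_ ?_
    · intro r hr m _
      exact Ideal.mul_mem_right (m : Γ(X, V)) _ hr
    · intro a b ha hb
      exact Ideal.add_mem _ ha hb
  · intro hs
    have h1 : (s : Γ(X, V)) • (show Γ(unitModule X, V) from (1 : Γ(X, V))) = s :=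
      mul_one (show Γ(X, V) from s)
    rw [← h1]
    exact Submodule.smul_mem_smul hs trivial

/-- **`Γ(V, 𝒪_X/𝓘) = Γ(V, 𝒪_X)/𝓘(V)` on an affine `V`, kernel form**: a function dies in `𝒪_X/𝓘𝒪_X` iff it
lies in `𝓘(V)`. [cite: GortzWedhorn2020, Prop. 7.14 (p. 186)] -/
theorem idealQuotπ_unit_app_eq_zero_iff (𝓘 : X.IdealSheafData) {V : X.Opens} (hV : IsAffineOpen V)
    (s : Γ(unitModule X, V)) :
    (idealQuotπ (unitModule X) 𝓘).app V s = 0 ↔ (s : Γ(X, V)) ∈ 𝓘.ideal ⟨V, hV⟩ := by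
  rw [idealQuotπ_app_eq_zero_iff (M := unitModule X) (J := 𝓘) IsAffineLocalizing.unit hV s]
  exact mem_ideal_smul_top_unitModule_iff 𝓘 ⟨V, hV⟩ s

/-- `Γ(V, 𝒪_X) → Γ(V, 𝒪_X/𝓘)` is onto on an affine `V`. [cite: GortzWedhorn2020, Prop. 7.14 (p. 186)] -/
theorem idealQuotπ_unit_app_surjective (𝓘 : X.IdealSheafData) {V : X.Opens} (hV : IsAffineOpen V) :
    Function.Surjective ((idealQuotπ (unitModule X) 𝓘).app V) :=
  idealQuotπ_app_surjective (M := unitModule X) (J := 𝓘) IsAffineLocalizing.unit hV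

variable {𝓐 𝓑}

/-- `(-φ)_W(y) = -φ_W(y)` on sections. [folklore] -/
private theorem neg_app_apply {M N : X.Modules} (φ : M ⟶ N) (W : X.Opens) (y : Γ(M, W)) :
    (-φ).app W y = -(φ.app W y) := by
  rw [eq_neg_iff_add_eq_zero, ← AddCommGrpCat.hom_add_apply, ← Scheme.Modules.Hom.add_app,
    neg_add_cancel, Scheme.Modules.Hom.zero_app]
  rfl

/-- A compatibility `(𝒪 → 𝒪/𝓘) ≫ q = (𝒪 → 𝒪/𝓙)` on sections. [cite: GortzWedhorn2020, Prop. 7.14 (p. 186)] -/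
theorem app_idealQuotπ_app_of_comp_eq {𝓘 𝓙 : X.IdealSheafData}
    {q : idealQuot (unitModule X) 𝓘 ⟶ idealQuot (unitModule X) 𝓙}
    (hq : idealQuotπ (unitModule X) 𝓘 ≫ q = idealQuotπ (unitModule X) 𝓙) (V : X.Opens)
    (s : Γ(unitModule X, V)) :
    q.app V ((idealQuotπ (unitModule X) 𝓘).app V s) = (idealQuotπ (unitModule X) 𝓙).app V s := by
  rw [← CategoryTheory.comp_apply, ← Scheme.Modules.Hom.comp_app, hq]

variable (q₁ : idealQuot (unitModule X) (𝓐 ⊓ 𝓑) ⟶ idealQuot (unitModule X) 𝓐)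
  (q₂ : idealQuot (unitModule X) (𝓐 ⊓ 𝓑) ⟶ idealQuot (unitModule X) 𝓑)
  (q₃ : idealQuot (unitModule X) 𝓐 ⟶ idealQuot (unitModule X) (𝓐 ⊔ 𝓑))
  (q₄ : idealQuot (unitModule X) 𝓑 ⟶ idealQuot (unitModule X) (𝓐 ⊔ 𝓑))
  (hq₁ : idealQuotπ (unitModule X) (𝓐 ⊓ 𝓑) ≫ q₁ = idealQuotπ (unitModule X) 𝓐)
  (hq₂ : idealQuotπ (unitModule X) (𝓐 ⊓ 𝓑) ≫ q₂ = idealQuotπ (unitModule X) 𝓑)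
  (hq₃ : idealQuotπ (unitModule X) 𝓐 ≫ q₃ = idealQuotπ (unitModule X) (𝓐 ⊔ 𝓑))
  (hq₄ : idealQuotπ (unitModule X) 𝓑 ≫ q₄ = idealQuotπ (unitModule X) (𝓐 ⊔ 𝓑))

include hq₁ hq₂ hq₃ hq₄ in
/-- The two composites `𝒪/(𝓐∩𝓑) → 𝒪/𝓐 → 𝒪/(𝓐+𝓑)` and `𝒪/(𝓐∩𝓑) → 𝒪/𝓑 → 𝒪/(𝓐+𝓑)` agree, so that
`lift(q₁,q₂) ≫ desc(q₃,−q₄) = 0`. [cite: Hartshorne1977, II Prop. 5.6 (p. 113)] -/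
theorem biprod_lift_desc_idealQuot_eq_zero :
    biprod.lift q₁ q₂ ≫ biprod.desc q₃ (-q₄) = 0 := by
  rw [biprod.lift_desc, Preadditive.comp_neg]
  have h : q₁ ≫ q₃ = q₂ ≫ q₄ := by
    apply idealQuot_hom_ext
    rw [← Category.assoc, hq₁, hq₃, ← Category.assoc, hq₂, hq₄]
  rw [h, add_neg_cancel]

include hq₁ hq₂ in
/-- **`𝒪/(𝓐∩𝓑) → 𝒪/𝓐 ⊕ 𝒪/𝓑` is a monomorphism** (on an affine `V`: `𝓐(V) ∩ 𝓑(V) = (𝓐 ⊓ 𝓑)(V)`).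
[cite: Hartshorne1977, II Prop. 5.6 (p. 113)] -/
theorem mono_biprod_lift_idealQuot : Mono (biprod.lift q₁ q₂) := by
  refine mono_of_injective_app_of_isAffineOpen _ fun V hV => ?_
  intro t t' htt'
  rw [← sub_eq_zero]
  rw [← sub_eq_zero, ← map_sub] at htt'
  generalize t - t' = s at htt' ⊢
  obtain ⟨c, rfl⟩ := idealQuotπ_unit_app_surjective (𝓐 ⊓ 𝓑) hV s
  have h1 : (idealQuotπ (unitModule X) 𝓐).app V c = 0 := by
    rw [← app_idealQuotπ_app_of_comp_eq hq₁ V c, ← biprod_lift_app_fst V q₁ q₂, htt', map_zero]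
  have h2 : (idealQuotπ (unitModule X) 𝓑).app V c = 0 := by
    rw [← app_idealQuotπ_app_of_comp_eq hq₂ V c, ← biprod_lift_app_snd V q₁ q₂, htt', map_zero]
  rw [idealQuotπ_unit_app_eq_zero_iff _ hV] at h1 h2 ⊢
  rw [Scheme.IdealSheafData.ideal_inf]
  exact ⟨h1, h2⟩

include hq₃ in
/-- **`𝒪/𝓐 ⊕ 𝒪/𝓑 → 𝒪/(𝓐+𝓑)` is an epimorphism** (already `𝒪/𝓐 → 𝒪/(𝓐+𝓑)` is onto on affines).
[cite: Hartshorne1977, II Prop. 5.6 (p. 113)] -/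
theorem epi_biprod_desc_idealQuot : Epi (biprod.desc q₃ (-q₄)) := by
  refine epi_of_surjective_app_of_isAffineOpen _ fun V hV => ?_
  intro u
  obtain ⟨c, rfl⟩ := idealQuotπ_unit_app_surjective (𝓐 ⊔ 𝓑) hV u
  refine ⟨(biprod.inl : _ ⟶ idealQuot (unitModule X) 𝓐 ⊞ idealQuot (unitModule X) 𝓑).app V
    ((idealQuotπ (unitModule X) 𝓐).app V c), ?_⟩
  rw [biprod_desc_app_inl_app, app_idealQuotπ_app_of_comp_eq hq₃ V c]

include hq₁ hq₂ hq₃ hq₄ in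
/-- **Exactness of `𝒪/(𝓐∩𝓑) → 𝒪/𝓐 ⊕ 𝒪/𝓑 → 𝒪/(𝓐+𝓑)` in the middle** (locally on an affine `W`: if
`a − b ∈ 𝓐(W) + 𝓑(W)`, `a − b = α + β`, then `c = a − α = b + β` reduces to `a` mod `𝓐` and to `b` mod `𝓑`).
[cite: Hartshorne1977, II Prop. 5.6 (p. 113)] -/
theorem exact_biprod_lift_desc_idealQuot :
    (ShortComplex.mk (biprod.lift q₁ q₂) (biprod.desc q₃ (-q₄))
      (biprod_lift_desc_idealQuot_eq_zero q₁ q₂ q₃ q₄ hq₁ hq₂ hq₃ hq₄)).Exact := by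
  refine exact_of_locally_exact _ fun V s hs x hx => ?_
  obtain ⟨W, hW, hxW, hWV⟩ := Opens.isBasis_iff_nbhd.mp X.isBasis_affineOpens hx
  refine ⟨W, homOfLE hWV, hxW, ?_⟩
  -- restrict to the affine `W`
  set P := idealQuot (unitModule X) 𝓐 ⊞ idealQuot (unitModule X) 𝓑 with hP
  set s' : Γ(P, W) := P.presheaf.map (homOfLE hWV).op s with hs'
  have hs'0 : (biprod.desc q₃ (-q₄)).app W s' = 0 := by
    have hnat : (biprod.desc q₃ (-q₄)).app W (P.presheaf.map (homOfLE hWV).op s) =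
        (idealQuot (unitModule X) (𝓐 ⊔ 𝓑)).presheaf.map (homOfLE hWV).op
          ((biprod.desc q₃ (-q₄)).app V s) :=
      ConcreteCategory.congr_hom ((biprod.desc q₃ (-q₄)).mapPresheaf.naturality (homOfLE hWV).op) s
    rw [hs', hnat, show (biprod.desc q₃ (-q₄)).app V s = 0 from hs, map_zero]
  -- lift the two components to functions `a`, `b` on `W`
  obtain ⟨a, ha⟩ := idealQuotπ_unit_app_surjective 𝓐 hW ((biprod.fst : P ⟶ _).app W s')
  obtain ⟨b, hb⟩ := idealQuotπ_unit_app_surjective 𝓑 hW ((biprod.snd : P ⟶ _).app W s')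
  -- `a - b ∈ 𝓐(W) + 𝓑(W)`
  have hab : ((a - b : Γ(unitModule X, W)) : Γ(X, W)) ∈ (𝓐 ⊔ 𝓑).ideal ⟨W, hW⟩ := by
    rw [← idealQuotπ_unit_app_eq_zero_iff _ hW, map_sub,
      ← app_idealQuotπ_app_of_comp_eq hq₃ W a, ← app_idealQuotπ_app_of_comp_eq hq₄ W b, ha, hb,
      ← hs'0, biprod_desc_app, neg_app_apply, sub_eq_add_neg]
  have hab' : ((a - b : Γ(unitModule X, W)) : Γ(X, W)) ∈ 𝓐.ideal ⟨W, hW⟩ ⊔ 𝓑.ideal ⟨W, hW⟩ := by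
    rw [Scheme.IdealSheafData.ideal_sup] at hab
    exact hab
  obtain ⟨α, hα, β, hβ, hαβ⟩ := Submodule.mem_sup.mp hab'
  -- `c := a - α`, with `α`, `β` read in `Γ(W, 𝒪_X)` as a module over itself
  set α' : Γ(unitModule X, W) := α with hα'
  set β' : Γ(unitModule X, W) := β with hβ'
  refine ⟨(idealQuotπ (unitModule X) (𝓐 ⊓ 𝓑)).app W (a - α'), ?_⟩
  change (biprod.lift q₁ q₂).app W _ = s'
  rw [← inl_app_fst_app_add_inr_app_snd_app W ((biprod.lift q₁ q₂).app W _), biprod_lift_app_fst,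
    biprod_lift_app_snd, app_idealQuotπ_app_of_comp_eq hq₁, app_idealQuotπ_app_of_comp_eq hq₂,
    ← inl_app_fst_app_add_inr_app_snd_app W s', ← ha, ← hb]
  congr 2
  · -- mod `𝓐`: `a - α ≡ a`
    rw [map_sub, sub_eq_self, idealQuotπ_unit_app_eq_zero_iff _ hW]
    exact hα
  · -- mod `𝓑`: `a - α = b + β ≡ b`
    have e : a - α' = b + β' := by
      have h1 : α' + β' = a - b := hαβ
      calc a - α' = a - b - α' + b := by abel
        _ = α' + β' - α' + b := by rw [h1]
        _ = b + β' := by abel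
    rw [e, map_add, add_eq_left, idealQuotπ_unit_app_eq_zero_iff _ hW]
    exact hβ

include hq₁ hq₂ hq₃ hq₄ in
/-- **The Chinese-remainder short exact sequence `0 → 𝒪_X/(𝓐∩𝓑) → 𝒪_X/𝓐 ⊕ 𝒪_X/𝓑 → 𝒪_X/(𝓐+𝓑) → 0`**
of `𝒪_X`-modules, for any two ideal sheaves `𝓐`, `𝓑` on a scheme `X` (any maps `qᵢ` compatible with the
projections from `𝒪_X`; they exist, `idealQuotDesc`). [cite: Hartshorne1977, II Prop. 5.6 (p. 113)] -/
theorem shortExact_crt_idealQuot :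
    (ShortComplex.mk (biprod.lift q₁ q₂) (biprod.desc q₃ (-q₄))
      (biprod_lift_desc_idealQuot_eq_zero q₁ q₂ q₃ q₄ hq₁ hq₂ hq₃ hq₄)).ShortExact :=
  haveI := mono_biprod_lift_idealQuot q₁ q₂ hq₁ hq₂
  haveI := epi_biprod_desc_idealQuot q₃ q₄ hq₃
  ShortComplex.ShortExact.mk' (exact_biprod_lift_desc_idealQuot q₁ q₂ q₃ q₄ hq₁ hq₂ hq₃ hq₄)
    inferInstance inferInstance

end CRT

end Literature.AlgebraicGeometry.Modules

namespace Literature.AlgebraicGeometry.Resolution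

/-! ## §2 Global sections: lengths are additive on short exact sequences with `Ȟ¹` of the kernel zero -/

section Lengths

variable {S : Type u} [CommRing S] {X : Scheme.{u}} (π : X ⟶ Spec (.of S))

/-- Isomorphic `𝒪_X`-modules have sections of the same `S`-length. [cite: Hartshorne1977, II Ex. 1.9] -/
theorem length_MSections_eq_of_iso {M N : X.Modules} (e : M ≅ N) (V : X.Opens) :
    Module.length S (MSections π M V) = Module.length S (MSections π N V) := by
  refine LinearEquiv.length_eq (LinearEquiv.ofLinear (MSections.app π e.hom V) (MSections.app π e.inv V) ?_ ?_)
  · apply LinearMap.ext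
    intro m
    rw [LinearMap.comp_apply, ← MSections.app_comp, e.inv_hom_id, MSections.app_id, LinearMap.id_apply]
  · apply LinearMap.ext
    intro m
    rw [LinearMap.comp_apply, ← MSections.app_comp, e.hom_inv_id, MSections.app_id, LinearMap.id_apply]

/-- **`h⁰(𝒪_X/𝓘) = length_S Γ(X, 𝒪_X/𝓘𝒪_X)`**: the `h0`-length of `Resolution/Lipman1969RationalContraction`
(global sections of the closed subscheme `V(𝓘)`) is the length of the global sections of the quotient MODULE
`𝒪_X/𝓘𝒪_X` (`Modules.idealQuot`), through `𝒪_X/𝓘_Z ≅ ι_*𝒪_Z` (`Modules.idealQuotIsoPushforwardUnit`) and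
`Γ(X, ι_*𝒪_Z) = Γ(Z, 𝒪_Z)`. [cite: Hartshorne1977, II Prop. 5.9 (p. 116)] -/
theorem h0_eq_length_MSections_idealQuot (𝓘 : X.IdealSheafData) :
    h0 π 𝓘 = Module.length S (MSections π (idealQuot (unitModule X) 𝓘) ⊤) := by
  -- `𝒪_X/𝓘𝒪_X ≅ ι_*𝒪_{V(𝓘)}`
  have e : idealQuot (unitModule X) 𝓘 ≅
      (Scheme.Modules.pushforward 𝓘.subschemeι).obj (unitModule 𝓘.subscheme) :=
    eqToIso (congrArg (fun J => idealQuot (unitModule X) J) (Scheme.IdealSheafData.ker_subschemeι 𝓘).symm)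
      ≪≫ idealQuotIsoPushforwardUnit 𝓘.subschemeι
  rw [length_MSections_eq_of_iso π e ⊤,
    (MSections.pushforwardEquiv π (𝓘.subschemeι ≫ π) 𝓘.subschemeι rfl (unitModule 𝓘.subscheme) ⊤).length_eq]
  rfl

/-- **Lengths of global sections are additive on a short exact sequence `0 → M′ → M → M″ → 0` with `M′`
affine-localizing and `Ȟ¹(𝒰, M′) = 0`** on some finite affine open cover `𝒰` (then
`0 → Γ(M′) → Γ(M) → Γ(M″) → 0` is exact). [cite: Hartshorne1977, III proof of Thm. 4.5 (p. 222)] -/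
theorem length_MSections_eq_add_of_shortExact {κ : Type u} (U : κ → X.Opens) (hUaff : ∀ i, IsAffineOpen (U i))
    (hUcov : ⨆ i, U i = ⊤) {T : ShortComplex X.Modules} (hT : T.ShortExact) (h₁ : IsAffineLocalizing T.X₁)
    (hH1 : Subsingleton (CechMH1 π T.X₁ U)) :
    Module.length S (MSections π T.X₂ ⊤) =
      Module.length S (MSections π T.X₁ ⊤) + Module.length S (MSections π T.X₃ ⊤) := by
  have hsec := sections_exact_of_shortExact hT ⊤
  refine Module.length_eq_add_of_exact (MSections.app π T.f ⊤) (MSections.app π T.g ⊤) hsec.1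
    (app_top_surjective_of_shortExact_of_subsingleton_cechMH1 π U hUaff hUcov hT h₁ hH1) ?_
  intro m
  constructor
  · intro hm
    obtain ⟨m', hm'⟩ := hsec.2 m hm
    exact ⟨m', hm'⟩
  · rintro ⟨m', rfl⟩
    exact app_app_eq_zero T ⊤ m'

/-- Lengths of global sections add on a binary direct sum, granted `Ȟ¹(𝒰, M) = 0`
(`Γ(X, M ⊕ N) = Γ(X, M) ⊕ Γ(X, N)`). [cite: Hartshorne1977, II Ex. 1.9] -/
theorem length_MSections_biprod {κ : Type u} (U : κ → X.Opens) (hUaff : ∀ i, IsAffineOpen (U i))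
    (hUcov : ⨆ i, U i = ⊤) (M N : X.Modules) (hM : IsAffineLocalizing M)
    (hH1 : Subsingleton (CechMH1 π M U)) :
    Module.length S (MSections π (M ⊞ N) ⊤) =
      Module.length S (MSections π M ⊤) + Module.length S (MSections π N ⊤) :=
  length_MSections_eq_add_of_shortExact π U hUaff hUcov
    (ShortComplex.Splitting.ofHasBinaryBiproduct M N).shortExact hM hH1

end Lengths

/-! ## §3 Inclusion–exclusion for `h0` -/

section InclusionExclusion

variable {S : Type u} [CommRing S] {X : Scheme.{u}} (π : X ⟶ Spec (.of S))

/-- `Ȟ¹(𝒰, 𝒪_X/𝓘𝒪_X) = 0` on a finite affine open cover from `H¹(V(𝓘), 𝒪) = 0` (`HasTrivialCechH1` of the closed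
subscheme): `𝒪_X/𝓘𝒪_X ≅ ι_*𝒪_{V(𝓘)}` and `Ȟ¹(𝒰, ι_*𝒪_Z) = Ȟ¹(ι⁻¹𝒰, 𝒪_Z)`. [cite: Hartshorne1977, III Ex. 4.1] -/
theorem subsingleton_cechMH1_idealQuot_of_hasTrivialCechH1 (𝓘 : X.IdealSheafData)
    (h : HasTrivialCechH1 (𝓘.subschemeι ≫ π)) {κ : Type u} [Finite κ] (U : κ → X.Opens)
    (hUaff : ∀ i, IsAffineOpen (U i)) (hUcov : ⨆ i, U i = ⊤) :
    Subsingleton (CechMH1 π (idealQuot (unitModule X) 𝓘) U) := by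
  have e : idealQuot (unitModule X) 𝓘 ≅
      (Scheme.Modules.pushforward 𝓘.subschemeι).obj (unitModule 𝓘.subscheme) :=
    eqToIso (congrArg (fun J => idealQuot (unitModule X) J) (Scheme.IdealSheafData.ker_subschemeι 𝓘).symm)
      ≪≫ idealQuotIsoPushforwardUnit 𝓘.subschemeι
  refine subsingleton_cechMH1_of_iso π U e ?_
  rw [subsingleton_cechMH1_pushforward_iff π 𝓘.subschemeι (unitModule 𝓘.subscheme) U,
    show CechMH1 (𝓘.subschemeι ≫ π) (unitModule 𝓘.subscheme) (fun i => 𝓘.subschemeι ⁻¹ᵁ U i) =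
      CechH1 (𝓘.subschemeι ≫ π) (fun i => 𝓘.subschemeι ⁻¹ᵁ U i) from CechMH1_unit _ _]
  exact h κ _ (fun i => (hUaff i).preimage 𝓘.subschemeι)
    (by rw [← Scheme.Hom.preimage_iSup, hUcov]; exact Opens.map_top _)

/-- A quasi-compact scheme has a finite affine open cover indexed by a type in its own universe. [folklore] -/
private theorem exists_finite_isAffineOpen_cover'' (X : Scheme.{u}) [CompactSpace X] :
    ∃ (κ : Type u) (_ : Finite κ) (U : κ → X.Opens), (∀ i, IsAffineOpen (U i)) ∧ ⨆ i, U i = ⊤ := by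
  obtain ⟨s, hs, e⟩ := (isCompact_iff_finite_and_eq_biUnion_affineOpens (U := (⊤ : X.Opens))).mp
    (by simpa using isCompact_univ)
  haveI := hs.to_subtype
  refine ⟨s, inferInstance, fun i => i.1.1, fun i => i.1.2, ?_⟩
  rw [iSup_subtype]
  exact e.symm

/-- **Inclusion–exclusion for `h⁰`**: on a quasi-compact `S`-scheme `π : X → Spec S`, for two ideal sheaves
`𝓐`, `𝓑` with `H¹(𝒪_{V(𝓐 ∩ 𝓑)}) = 0` and `H¹(𝒪_{V(𝓐)}) = 0`,
`h⁰(𝒪_X/(𝓐∩𝓑)) + h⁰(𝒪_X/(𝓐+𝓑)) = h⁰(𝒪_X/𝓐) + h⁰(𝒪_X/𝓑)` (`Resolution.h0`, lengths over `S`, in `ℕ∞`):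
the global sections of the Chinese-remainder sequence `0 → 𝒪/(𝓐∩𝓑) → 𝒪/𝓐 ⊕ 𝒪/𝓑 → 𝒪/(𝓐+𝓑) → 0` are
exact because `H¹(𝒪/(𝓐∩𝓑)) = 0`. This is the additivity of `χ = h⁰` used throughout Lipman's §13
(e.g. proof of Prop. (13.1) d), p. 223, and §§18–23). [cite: Lipman1969, Section 13 (p. 223)]
[cite: Hartshorne1977, III proof of Thm. 4.5 (p. 222)] -/
theorem h0_inf_add_h0_sup [CompactSpace X] (𝓐 𝓑 : X.IdealSheafData)
    (hinf : HasTrivialCechH1 ((𝓐 ⊓ 𝓑).subschemeι ≫ π)) (h𝓐 : HasTrivialCechH1 (𝓐.subschemeι ≫ π)) :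
    h0 π (𝓐 ⊓ 𝓑) + h0 π (𝓐 ⊔ 𝓑) = h0 π 𝓐 + h0 π 𝓑 := by
  obtain ⟨κ, _, U, hUaff, hUcov⟩ := exists_finite_isAffineOpen_cover'' X
  -- the comparison maps between the quotients
  let q₁ : idealQuot (unitModule X) (𝓐 ⊓ 𝓑) ⟶ idealQuot (unitModule X) 𝓐 :=
    idealQuotDesc ((isKilledBy_idealQuot (unitModule X) 𝓐).anti inf_le_left) (idealQuotπ _ 𝓐)
  let q₂ : idealQuot (unitModule X) (𝓐 ⊓ 𝓑) ⟶ idealQuot (unitModule X) 𝓑 :=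
    idealQuotDesc ((isKilledBy_idealQuot (unitModule X) 𝓑).anti inf_le_right) (idealQuotπ _ 𝓑)
  let q₃ : idealQuot (unitModule X) 𝓐 ⟶ idealQuot (unitModule X) (𝓐 ⊔ 𝓑) :=
    idealQuotDesc ((isKilledBy_idealQuot (unitModule X) (𝓐 ⊔ 𝓑)).anti le_sup_left) (idealQuotπ _ _)
  let q₄ : idealQuot (unitModule X) 𝓑 ⟶ idealQuot (unitModule X) (𝓐 ⊔ 𝓑) :=
    idealQuotDesc ((isKilledBy_idealQuot (unitModule X) (𝓐 ⊔ 𝓑)).anti le_sup_right) (idealQuotπ _ _)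
  have hq₁ : idealQuotπ (unitModule X) (𝓐 ⊓ 𝓑) ≫ q₁ = idealQuotπ (unitModule X) 𝓐 := idealQuotπ_desc _ _
  have hq₂ : idealQuotπ (unitModule X) (𝓐 ⊓ 𝓑) ≫ q₂ = idealQuotπ (unitModule X) 𝓑 := idealQuotπ_desc _ _
  have hq₃ : idealQuotπ (unitModule X) 𝓐 ≫ q₃ = idealQuotπ (unitModule X) (𝓐 ⊔ 𝓑) := idealQuotπ_desc _ _
  have hq₄ : idealQuotπ (unitModule X) 𝓑 ≫ q₄ = idealQuotπ (unitModule X) (𝓐 ⊔ 𝓑) := idealQuotπ_desc _ _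
  have hT := shortExact_crt_idealQuot q₁ q₂ q₃ q₄ hq₁ hq₂ hq₃ hq₄
  -- `Ȟ¹` of the kernel and of `𝒪/𝓐` vanish on `𝒰`
  have hH1inf := subsingleton_cechMH1_idealQuot_of_hasTrivialCechH1 π (𝓐 ⊓ 𝓑) hinf U hUaff hUcov
  have hH1𝓐 := subsingleton_cechMH1_idealQuot_of_hasTrivialCechH1 π 𝓐 h𝓐 U hUaff hUcov
  have h1 := length_MSections_eq_add_of_shortExact π U hUaff hUcov hT
    (isAffineLocalizing_idealQuot _ IsAffineLocalizing.unit) hH1inf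
  have h2 := length_MSections_biprod π U hUaff hUcov (idealQuot (unitModule X) 𝓐)
    (idealQuot (unitModule X) 𝓑) (isAffineLocalizing_idealQuot _ IsAffineLocalizing.unit) hH1𝓐
  rw [h0_eq_length_MSections_idealQuot, h0_eq_length_MSections_idealQuot,
    h0_eq_length_MSections_idealQuot, h0_eq_length_MSections_idealQuot]
  change Module.length S (MSections π (idealQuot (unitModule X) (𝓐 ⊓ 𝓑)) ⊤) +
      Module.length S (MSections π (idealQuot (unitModule X) (𝓐 ⊔ 𝓑)) ⊤) =
    Module.length S (MSections π (idealQuot (unitModule X) 𝓐) ⊤) +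
      Module.length S (MSections π (idealQuot (unitModule X) 𝓑) ⊤)
  rw [← h2]
  exact h1.symm

/-- **Inclusion–exclusion for `h⁰` on a resolution of a surface germ with `H¹(X, 𝒪_X) = 0`**: for `A` a
Noetherian local domain of Krull dimension `2`, `π : X → Spec A` a resolution (`X` integral) with
`H¹(X, 𝒪_X) = 0`, and ANY two ideal sheaves `𝓐`, `𝓑` on `X`,
`h⁰(𝒪_X/(𝓐∩𝓑)) + h⁰(𝒪_X/(𝓐+𝓑)) = h⁰(𝒪_X/𝓐) + h⁰(𝒪_X/𝓑)` — every closed subscheme of `X` has `H¹(𝒪) = 0`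
(`IsResolution.hasTrivialCechH1_subschemeι_comp`, i.e. `Ȟ² = 0` on the resolution, Görtz–Wedhorn II 24.44).
With `𝓐 = 𝓘_E`, `𝓑 = 𝓘_F` the ideals of two exceptional curves without common component (`𝓘_E ∩ 𝓘_F = 𝓘_E𝓘_F`
on the regular `X`) this is Lipman's `χ(E) + χ(F) − χ(E + F) = h⁰(𝒪_{E ∩ F})` (proof of Prop. (13.1) d)).
[cite: Lipman1969, Proposition (13.1) d), proof (p. 223)] [cite: GortzWedhorn2023, Cor. 24.44] -/
theorem IsResolution.h0_inf_add_h0_sup {A : Type u} [CommRing A] [IsNoetherianRing A] [IsLocalRing A]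
    [IsDomain A] {X : Scheme.{u}} [IsIntegral X] [IsLocallyNoetherian X] (π : X ⟶ Spec (.of A))
    (hA : ringKrullDim A = 2) (hπ : IsResolution π) (h1 : HasTrivialCechH1 π) (𝓐 𝓑 : X.IdealSheafData) :
    h0 π (𝓐 ⊓ 𝓑) + h0 π (𝓐 ⊔ 𝓑) = h0 π 𝓐 + h0 π 𝓑 := by
  haveI : IsProper π := hπ.isProper
  haveI : CompactSpace X := QuasiCompact.compactSpace_of_compactSpace π
  exact Literature.AlgebraicGeometry.Resolution.h0_inf_add_h0_sup π 𝓐 𝓑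
    (hπ.hasTrivialCechH1_subschemeι_comp π hA h1 (𝓐 ⊓ 𝓑)) (hπ.hasTrivialCechH1_subschemeι_comp π hA h1 𝓐)

/-- **The rational regime** of the named facts `Lipman1969_13_1_b_rat` / `_13_1_d_rat` / `_27_1_reg_rat` /
`_27_3_rat`: for `S` a two-dimensional normal Noetherian local domain with a rational singularity, `π : X → Spec S`
any desingularization and `𝓐`, `𝓑` any ideal sheaves on `X`,
`h0 π (𝓐 ⊓ 𝓑) + h0 π (𝓐 ⊔ 𝓑) = h0 π 𝓐 + h0 π 𝓑` — GIVEN Prop. (1.2) 2) (`H¹(X, 𝒪_X) = 0` for this `π`; the named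
fact `Lipman1969_1_2`, hypothesis `h12`). [cite: Lipman1969, Section 13 (p. 223) with Proposition (1.2) 2) (p. 199)] -/
theorem h0_inf_add_h0_sup_of_hasRationalSingularity (h12 : Lipman1969_1_2.{u})
    {S : Type u} [CommRing S] [IsNoetherianRing S] [IsLocalRing S] [IsDomain S] [IsIntegrallyClosed S]
    (hdim : ringKrullDim S = 2) (hrat : HasRationalSingularity S)
    {X : Scheme.{u}} (π : X ⟶ Spec (.of S)) (hπ : IsResolution π) (𝓐 𝓑 : X.IdealSheafData) :
    h0 π (𝓐 ⊓ 𝓑) + h0 π (𝓐 ⊔ 𝓑) = h0 π 𝓐 + h0 π 𝓑 := by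
  haveI : IsIntegral X := hπ.isIntegral_source
  haveI : IsProper π := hπ.isProper
  haveI : IsLocallyNoetherian X := LocallyOfFiniteType.isLocallyNoetherian π
  exact hπ.h0_inf_add_h0_sup π hdim (h12.hasTrivialCechH1_of_isResolution hdim hrat π hπ) 𝓐 𝓑

end InclusionExclusion

end Literature.AlgebraicGeometry.Resolution

end
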